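import Literature.AlgebraicGeometry.Resolution.RegularHomRegularLocus
import Literature.AlgebraicGeometry.Resolution.FlatSlicingCriterion
import Mathlib.RingTheory.Ideal.AssociatedPrime.Basic
import Mathlib.RingTheory.TensorProduct.Quotient
import HarnessLib

/-!
# The extension `P Â` of a prime `P` of a local G-ring `A` to the completion is a radical ideal

Topic: `Literature/AlgebraicGeometry/Resolution`. Commutative algebra for reading an irreducible
subvariety `V(P)` through a point on the completion of the local ring at that point (de Jong
1996, 3.4–3.5: "the complete local ring of `T` at `x` corresponds to the quotient map
`B → A'/tᵢA'`"): for a Noetherian local ring `A`, its `𝔪`-adic completion `Â` and a prime `P`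
of `A`,

* `mem_map_of_algebraMap_mul_mem_map` — along a flat algebra `S`, `S/PS` is torsion-free over
  the domain `A/P`: `r ∉ P`, `r w ∈ PS` force `w ∈ PS`;
* `IsRegularHom.isRegularLocalRing_localization_quotient_map_under` — along a regular
  homomorphism `A → B` of Noetherian rings the closed fibres `B_𝔔/𝔭B_𝔔` (`𝔭 = 𝔔 ∩ A`) are
  regular local rings (they are local rings of the fibre ring `κ(𝔭) ⊗_A B`, which is regular;
  Matsumura §32, EGA IV₂ 7.3);
* `IsGRing.isRadical_map_adicCompletion` — **for a Noetherian local G-ring `A` and a prime `P`,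
  the ideal `P Â` is radical**, i.e. `Â/PÂ = (A/P)^` is reduced (EGA IV₂ 7.8.3 (vii)/(x): a
  quotient of an excellent local domain is analytically unramified; Matsumura §32: the formal
  fibres of a G-ring are geometrically regular). Proof: a nilpotent `x̄ ≠ 0` of `Â/PÂ` has its
  annihilator inside an associated prime `𝔔`; associated primes of the torsion-free
  `A/P`-module `Â/PÂ` contract to `P`, so `Â_𝔔/PÂ_𝔔` is a local ring of the formal fibre over
  `P`, regular, hence a domain, in which the image of `x` — nilpotent — vanishes: some
  `s ∉ 𝔔` kills `x̄`, contradicting `Ann(x̄) ⊆ 𝔔`;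
* `IsGRing.map_adicCompletion_eq_of_forall_minimalPrimes` — consequently `P Â = 𝔔` as soon as
  `𝔔` is the only minimal prime of `P Â`.

## Sources

* A. Grothendieck, EGA IV₂ (Publ. Math. IHÉS 24, 1965), 7.3, Scholie 7.8.3 (v), (vii), (x).
* H. Matsumura, *Commutative Ring Theory* (1986), §32 pp. 255–260 (G-rings and formal fibres),
  Thm. 7.5 (flatness and torsion). [Matsumura1987]
* The minimal primes of `P Â` contract to `P` (going down along the flat `A → Â`):
  `Ideal.under_eq_of_mem_minimalPrimes_map` of `AlterationsSingularComponentsGlue.lean`.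
-/

noncomputable section

open IsLocalRing TensorProduct

namespace Literature.AlgebraicGeometry.Resolution

universe u

/-! ## Torsion-freeness of `S/PS` -/

section Torsion

variable {A S : Type u} [CommRing A] [CommRing S] [Algebra A S]

/-- **`S/PS` is torsion-free over `A/P` for `S` flat over `A`**: if `r ∉ P` and `r·w ∈ PS` then
`w ∈ PS` (`S/PS = S ⊗_A A/P` is flat over the domain `A/P`, and flat modules over a domain are
torsion-free, Matsumura Thm. 7.5 ff.). [cite: Matsumura1987, §7 p. 51] -/
theorem mem_map_of_algebraMap_mul_mem_map [Module.Flat A S] (P : Ideal A) [P.IsPrime] {r : A}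
    (hr : r ∉ P) {w : S} (h : algebraMap A S r * w ∈ P.map (algebraMap A S)) :
    w ∈ P.map (algebraMap A S) := by
  -- `S/PS` is a flat `A/P`-module
  let e : (S ⧸ P.map (algebraMap A S)) ≃ₐ[A ⧸ P] (A ⧸ P) ⊗[A] S :=
    Algebra.TensorProduct.quotIdealMapEquivQuotTensor S P
  haveI : Module.Flat (A ⧸ P) (S ⧸ P.map (algebraMap A S)) :=
    Module.Flat.of_linearEquiv e.toLinearEquiv
  -- `r̄ ≠ 0` in the domain `A/P` is a non-zero-divisor on `S/PS`
  have hr0 : (Ideal.Quotient.mk P r) ∈ nonZeroDivisors (A ⧸ P) :=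
    mem_nonZeroDivisors_of_ne_zero fun h0 => hr (Ideal.Quotient.eq_zero_iff_mem.mp h0)
  have hreg : IsSMulRegular (S ⧸ P.map (algebraMap A S)) (Ideal.Quotient.mk P r) :=
    Module.Flat.isSMulRegular_of_nonZeroDivisors hr0
  have hsmul : (Ideal.Quotient.mk P r) • (Ideal.Quotient.mk (P.map (algebraMap A S)) w) = 0 := by
    rw [Algebra.smul_def, Ideal.Quotient.algebraMap_quotient_map_quotient, ← map_mul,
      Ideal.Quotient.eq_zero_iff_mem]
    exact h
  have h0 : Ideal.Quotient.mk (P.map (algebraMap A S)) w = 0 := hreg.right_eq_zero_of_smul hsmul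
  exact Ideal.Quotient.eq_zero_iff_mem.mp h0

end Torsion

/-! ## The closed fibres of a regular homomorphism are regular -/

namespace IsRegularHom

variable {A B : Type u} [CommRing A] [CommRing B] [Algebra A B]

/-- **Along a regular homomorphism the closed fibres `B_𝔔/𝔭B_𝔔` are regular local rings**
(`𝔭 = 𝔔 ∩ A`): `B_𝔔/𝔭B_𝔔` is the local ring of the fibre ring `κ(𝔭) ⊗_A B` at the prime
corresponding to `𝔔` (Mathlib's `Ideal.Fiber.localizationAlgEquivQuotient`), and the fibre
ring is (geometrically) regular by hypothesis. [cite: Matsumura1987, §32 p. 256] -/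
theorem isRegularLocalRing_localization_quotient_map_under (h : IsRegularHom A B) (Q : Ideal B)
    [Q.IsPrime] :
    IsRegularLocalRing (Localization.AtPrime Q ⧸
      (Q.under A).map (algebraMap A (Localization.AtPrime Q))) := by
  set p : Ideal A := Q.under A with hp
  haveI : Module.Flat A B := h.1
  -- the fibre ring over `𝔭` is regular (geometric regularity with `k' = κ(𝔭)`)
  have hF : IsRegularRing (p.Fiber B) := by
    haveI : IsRegularRing (p.ResidueField ⊗[p.ResidueField] (p.ResidueField ⊗[A] B)) :=
      h.2 p p.ResidueField inferInstance
    exact IsRegularRing.of_ringEquiv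
      (R := p.ResidueField ⊗[p.ResidueField] (p.ResidueField ⊗[A] B))
      (Algebra.TensorProduct.lid p.ResidueField (p.Fiber B)).toRingEquiv
  -- the prime of the fibre ring under `𝔔`
  let q : PrimeSpectrum (p.Fiber B) :=
    PrimeSpectrum.primesOverOrderIsoFiber A B p ⟨Q, inferInstance, inferInstance⟩
  have hq : q.asIdeal.comap (Algebra.TensorProduct.includeRight : B →ₐ[A] p.Fiber B) = Q := by
    have h1 := PrimeSpectrum.coe_primesOverOrderIsoFiber_symm_apply (R := A) (S := B) p q
    rw [OrderIso.symm_apply_apply] at h1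
    exact h1.symm
  haveI : IsRegularLocalRing (Localization.AtPrime q.asIdeal) :=
    IsRegularRing.isRegularLocalRing_localization q.asIdeal
  -- `(κ(𝔭) ⊗ B)_𝔮 ≅ B_𝔯/𝔭B_𝔯` with `𝔯 = 𝔮 ∩ B = 𝔔`
  set r : Ideal B := q.asIdeal.comap (Algebra.TensorProduct.includeRight : B →ₐ[A] p.Fiber B)
    with hr
  letI : Algebra (Localization.AtPrime p) (Localization.AtPrime r) :=
    Localization.AtPrime.algebraOfLiesOver p r
  let e := Ideal.Fiber.localizationAlgEquivQuotient p q.asIdeal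
  haveI hreg : IsRegularLocalRing (Localization.AtPrime r ⧸
      p.map (algebraMap A (Localization.AtPrime r))) :=
    IsRegularLocalRing.of_ringEquiv (R := Localization.AtPrime q.asIdeal) e.toRingEquiv
  -- transport from `𝔯` to `𝔔` (equal ideals)
  have hM : r.primeCompl = Q.primeCompl := by
    ext x
    change x ∉ r ↔ x ∉ Q
    rw [hq]
  haveI : IsLocalization.AtPrime (Localization.AtPrime Q) r := by
    change IsLocalization r.primeCompl _
    rw [hM]
    exact Localization.isLocalization
  let e2 : Localization.AtPrime r ≃ₐ[B] Localization.AtPrime Q :=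
    IsLocalization.algEquiv r.primeCompl _ _
  have hmap : p.map (algebraMap A (Localization.AtPrime Q)) =
      (p.map (algebraMap A (Localization.AtPrime r))).map e2.toRingEquiv.toRingHom := by
    rw [Ideal.map_map]
    congr 1
    rw [IsScalarTower.algebraMap_eq A B (Localization.AtPrime r),
      IsScalarTower.algebraMap_eq A B (Localization.AtPrime Q), ← RingHom.comp_assoc]
    congr 1
    ext b
    simp
  exact IsRegularLocalRing.of_ringEquiv
    (R := Localization.AtPrime r ⧸ p.map (algebraMap A (Localization.AtPrime r)))
    (Ideal.quotientEquiv _ _ e2.toRingEquiv hmap)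

end IsRegularHom

/-! ## `P Â` is radical for a local G-ring -/

namespace IsGRing

variable {A : Type u} [CommRing A] [IsLocalRing A]

/-- **For a Noetherian local G-ring `A` and a prime `P` of `A`, the ideal `P Â` of the
completion is radical** (`Â/PÂ = (A/P)^` is reduced; EGA IV₂ 7.8.3 (vii), (x) for the
(quasi-)excellent local ring `A`; Matsumura §32: the formal fibres of `A` are geometrically
regular). A nilpotent `x̄ ≠ 0` of `Â/PÂ` has `Ann(x̄)` inside an associated prime `𝔔`
(`Â` is Noetherian); `𝔔 ∩ A = P` because `Â/PÂ` is torsion-free over `A/P` (`Â` is flat over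
`A`); the local ring `Â_𝔔/PÂ_𝔔` of the formal fibre over `P` is regular, hence a domain, so the
nilpotent image of `x` vanishes there and some `s ∉ 𝔔` has `s x ∈ PÂ`, i.e. `s ∈ Ann(x̄) ⊆ 𝔔`,
a contradiction. [cite: Matsumura1987, §32 p. 256] -/
theorem isRadical_map_adicCompletion (hA : IsGRing A) (P : Ideal A) [P.IsPrime] :
    (P.map (algebraMap A (AdicCompletion (maximalIdeal A) A))).IsRadical := by
  classical
  haveI : IsNoetherianRing A := hA.1
  set Ah := AdicCompletion (maximalIdeal A) A with hAh
  haveI : IsNoetherianRing Ah := isNoetherianRing_adicCompletion_maximalIdeal A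
  have h : IsRegularHom A Ah := hA.isRegularHom_adicCompletion
  haveI : Module.Flat A Ah := h.1
  set J : Ideal Ah := P.map (algebraMap A Ah) with hJ
  intro x hx
  obtain ⟨n, hn⟩ := Ideal.mem_radical_iff.mp hx
  by_contra hxJ
  -- the annihilator of `x̄ ≠ 0` in `Â/PÂ` lies in an associated prime `𝔔`
  have hx0 : (Ideal.Quotient.mk J x) ≠ 0 := fun h0 => hxJ (Ideal.Quotient.eq_zero_iff_mem.mp h0)
  obtain ⟨Q, hQass, hcolon⟩ := exists_le_isAssociatedPrime_of_isNoetherianRing Ah _ hx0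
  haveI hQp : Q.IsPrime := hQass.toIsPrime
  obtain ⟨w, hw⟩ := hQass.eq_radical_colon
  obtain ⟨w', rfl⟩ := Ideal.Quotient.mk_surjective w
  -- `𝔔 ∩ A = P`
  have hJQ : J ≤ Q := by
    intro j hj
    rw [hw]
    refine Ideal.le_radical ?_
    rw [Submodule.mem_colon_singleton, Submodule.mem_bot,
      show j • Ideal.Quotient.mk J w' = Ideal.Quotient.mk J (j * w') from rfl,
      Ideal.Quotient.eq_zero_iff_mem]
    exact J.mul_mem_right _ hj
  have hQP : Q.under A = P := by
    refine le_antisymm ?_ (by rw [← Ideal.map_le_iff_le_comap]; exact hJQ)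
    intro r hr
    by_contra hrP
    rw [Ideal.mem_comap, hw, Ideal.mem_radical_iff] at hr
    obtain ⟨N, hN⟩ := hr
    rw [Submodule.mem_colon_singleton, Submodule.mem_bot,
      show (algebraMap A Ah r ^ N) • Ideal.Quotient.mk J w' =
        Ideal.Quotient.mk J (algebraMap A Ah r ^ N * w') from rfl,
      Ideal.Quotient.eq_zero_iff_mem, ← map_pow] at hN
    -- `r^N ∉ P`, `r^N w' ∈ PÂ` ⟹ `w' ∈ PÂ` ⟹ `𝔔 = ⊤`
    have hrN : r ^ N ∉ P := fun hmem => hrP (‹P.IsPrime›.mem_of_pow_mem N hmem)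
    have hw' : w' ∈ J := mem_map_of_algebraMap_mul_mem_map P hrN hN
    have htop : Q = ⊤ := by
      rw [hw, Ideal.radical_eq_top]
      refine eq_top_iff.mpr fun s _ => ?_
      rw [Submodule.mem_colon_singleton, Ideal.Quotient.eq_zero_iff_mem.mpr hw', smul_zero]
      exact Submodule.zero_mem _
    exact hQp.ne_top htop
  -- the local ring `Â_𝔔/PÂ_𝔔` of the formal fibre over `P` is regular, hence a domain
  have hreg := h.isRegularLocalRing_localization_quotient_map_under Q
  rw [hQP] at hreg
  set L := Localization.AtPrime Q with hL
  haveI : IsRegularLocalRing (L ⧸ P.map (algebraMap A L)) := hreg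
  haveI : IsDomain (L ⧸ P.map (algebraMap A L)) := isDomain_of_isRegularLocalRing _
  -- the image of `x` is nilpotent there, hence zero
  have hJL : J.map (algebraMap Ah L) = P.map (algebraMap A L) := by
    rw [hJ, Ideal.map_map, ← IsScalarTower.algebraMap_eq]
  have hxL : algebraMap Ah L x ∈ J.map (algebraMap Ah L) := by
    rw [hJL, ← Ideal.Quotient.eq_zero_iff_mem]
    refine IsReduced.eq_zero _ ⟨n, ?_⟩
    rw [← map_pow, ← map_pow, Ideal.Quotient.eq_zero_iff_mem, ← hJL]
    exact Ideal.mem_map_of_mem _ hn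
  obtain ⟨s, hs, hsx⟩ := (IsLocalization.algebraMap_mem_map_algebraMap_iff Q.primeCompl L J x).mp hxL
  -- so `s ∈ Ann(x̄) ⊆ 𝔔`, contradicting `s ∉ 𝔔`
  refine hs (hcolon ?_)
  rw [Submodule.mem_colon_singleton, Submodule.mem_bot,
    show s • Ideal.Quotient.mk J x = Ideal.Quotient.mk J (s * x) from rfl,
    Ideal.Quotient.eq_zero_iff_mem]
  exact hsx

/-- Hence **`P Â = 𝔔` as soon as every minimal prime of `P Â` equals `𝔔`** (a radical ideal is
the intersection of its minimal primes). [folklore] -/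
theorem map_adicCompletion_eq_of_forall_minimalPrimes (hA : IsGRing A) (P : Ideal A) [P.IsPrime]
    {Q : Ideal (AdicCompletion (maximalIdeal A) A)}
    (hQ : Q ∈ (P.map (algebraMap A (AdicCompletion (maximalIdeal A) A))).minimalPrimes)
    (huniq : ∀ Q' ∈ (P.map (algebraMap A (AdicCompletion (maximalIdeal A) A))).minimalPrimes,
      Q' = Q) :
    P.map (algebraMap A (AdicCompletion (maximalIdeal A) A)) = Q := by
  set J := P.map (algebraMap A (AdicCompletion (maximalIdeal A) A)) with hJ
  have hrad : J.radical = J := (hA.isRadical_map_adicCompletion P).radical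
  have hmin : J.minimalPrimes = {Q} := by
    ext Q'
    simp only [Set.mem_singleton_iff]
    exact ⟨fun h => huniq Q' h, fun h => h ▸ hQ⟩
  rw [← hrad, ← Ideal.sInf_minimalPrimes, hmin, sInf_singleton]

end IsGRing

end Literature.AlgebraicGeometry.Resolution

end
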